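import Mathlib
import HarnessLib

/-!
# Conditional expectation is local: `X₁ = X₂` on `B ∈ 𝓕` implies `E(X₁|𝓕) = E(X₂|𝓕)` a.s. on `B`
# (Durrett 2019, §4.1 Theorem 4.1.2)

Topic `Probability/Process` (Durrett Chapter 4, conditional expectation; siblings
`CondExpCauchySchwarzPythagoras.lean`, `CondExpHolderInequality.lean`); namespace
`Literature.Probability.Process`.  THEOREMS ONLY: everything is PROVED; no definition, no named
fact, no axiom.

Source, VERBATIM [cite: Durrett2019, §4.1 Theorem 4.1.2, p. 190 of the held copy
`book:durrett2019-probability-theory-examples` (PDF p0202:L5)]: "**Theorem 4.1.2** If `X₁ = X₂` on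
`B ∈ 𝓕`, then `E(X₁|𝓕) = E(X₂|𝓕)` a.s. on `B`."  (Durrett's standing convention in §4.1 is that the
variables are integrable; conditional expectation is Mathlib's `μ[X|m]` = `MeasureTheory.condExp`,
for which the statement is derived from `condExp_indicator`:
`1_B E(X₁|𝓕) = E(1_B X₁|𝓕) = E(1_B X₂|𝓕) = 1_B E(X₂|𝓕)` a.s.)

WHAT IS TYPED (values in a real Banach space `E`, any measure, any sub-σ-algebra `m` — Mathlib's
`condExp` is `0` in the degenerate cases, where the conclusion is trivial):
* **`Durrett2019_thm_4_1_2`** — hypothesis "`X₁ = X₂` on `B`" in the a.e. form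
  `∀ᵐ ω, ω ∈ B → X₁ ω = X₂ ω`, conclusion `∀ᵐ ω, ω ∈ B → E(X₁|m) ω = E(X₂|m) ω`;
* `Durrett2019_thm_4_1_2_of_eqOn` — the pointwise hypothesis `Set.EqOn X₁ X₂ B` as printed;
* `Durrett2019_thm_4_1_2_restrict` — the conclusion as `E(X₁|m) =ᵐ[μ|_B] E(X₂|m)`;
* `indicator_condExp_ae_eq_of_indicator_ae_eq` — the form `1_B X₁ = 1_B X₂ a.e. ⟹
  1_B E(X₁|m) = 1_B E(X₂|m) a.e.` used in the proof.

## References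
* R. Durrett, *Probability: Theory and Examples*, 5th ed. (CUP 2019), §4.1 Theorem 4.1.2 (p. 190).
  [cite: Durrett2019]
-/

noncomputable section

namespace Literature.Probability.Process

open _root_.MeasureTheory _root_.Set _root_.Filter

variable {Ω E : Type*} {m m0 : MeasurableSpace Ω} {μ : Measure Ω} [NormedAddCommGroup E]
  [NormedSpace ℝ E] [CompleteSpace E] {B : Set Ω} {X₁ X₂ : Ω → E}

/-- `1_B X₁ = 1_B X₂` a.e. implies `1_B E(X₁|m) = 1_B E(X₂|m)` a.e., for `B ∈ m` and integrable
`X₁, X₂` (Mathlib `condExp_indicator`: `E(1_B X|𝓕) = 1_B E(X|𝓕)` for `B ∈ 𝓕`).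
[cite: Durrett2019, §4.1 Theorem 4.1.2 (proof)] -/
theorem indicator_condExp_ae_eq_of_indicator_ae_eq (hB : MeasurableSet[m] B)
    (h1 : Integrable X₁ μ) (h2 : Integrable X₂ μ) (h : B.indicator X₁ =ᵐ[μ] B.indicator X₂) :
    B.indicator (μ[X₁|m]) =ᵐ[μ] B.indicator (μ[X₂|m]) :=
  ((condExp_indicator h1 hB).symm.trans (condExp_congr_ae h)).trans (condExp_indicator h2 hB)

/-- **Theorem 4.1.2** (Durrett 2019): if `X₁ = X₂` (a.s.) on `B ∈ 𝓕` then `E(X₁|𝓕) = E(X₂|𝓕)`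
a.s. on `B` (integrable `X₁, X₂` with values in a real Banach space; `𝓕 = m` any σ-algebra on
`Ω`). [cite: Durrett2019, §4.1 Theorem 4.1.2] -/
theorem Durrett2019_thm_4_1_2 (hB : MeasurableSet[m] B) (h1 : Integrable X₁ μ)
    (h2 : Integrable X₂ μ) (h : ∀ᵐ ω ∂μ, ω ∈ B → X₁ ω = X₂ ω) :
    ∀ᵐ ω ∂μ, ω ∈ B → (μ[X₁|m]) ω = (μ[X₂|m]) ω := by
  have hind : B.indicator X₁ =ᵐ[μ] B.indicator X₂ := by
    filter_upwards [h] with ω hω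
    by_cases hb : ω ∈ B
    · rw [indicator_of_mem hb, indicator_of_mem hb, hω hb]
    · rw [indicator_of_notMem hb, indicator_of_notMem hb]
  filter_upwards [indicator_condExp_ae_eq_of_indicator_ae_eq hB h1 h2 hind] with ω hω hb
  rwa [indicator_of_mem hb, indicator_of_mem hb] at hω

/-- **Theorem 4.1.2**, hypothesis as printed (`X₁ = X₂` everywhere on `B`).
[cite: Durrett2019, §4.1 Theorem 4.1.2] -/
theorem Durrett2019_thm_4_1_2_of_eqOn (hB : MeasurableSet[m] B) (h1 : Integrable X₁ μ)
    (h2 : Integrable X₂ μ) (h : EqOn X₁ X₂ B) :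
    ∀ᵐ ω ∂μ, ω ∈ B → (μ[X₁|m]) ω = (μ[X₂|m]) ω :=
  Durrett2019_thm_4_1_2 hB h1 h2 (Eventually.of_forall fun _ hω => h hω)

/-- **Theorem 4.1.2**, conclusion as an a.e. equality for the restricted measure `μ|_B` (here `m`
is a sub-σ-algebra of the ambient one, so that `B` is an event).
[cite: Durrett2019, §4.1 Theorem 4.1.2] -/
theorem Durrett2019_thm_4_1_2_restrict (hm : m ≤ m0) (hB : MeasurableSet[m] B)
    (h1 : Integrable X₁ μ) (h2 : Integrable X₂ μ) (h : ∀ᵐ ω ∂μ, ω ∈ B → X₁ ω = X₂ ω) :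
    μ[X₁|m] =ᵐ[μ.restrict B] μ[X₂|m] := by
  rw [EventuallyEq, ae_restrict_iff' (hm B hB)]
  exact Durrett2019_thm_4_1_2 hB h1 h2 h

end Literature.Probability.Process
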